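import Mathlib.Analysis.Complex.Liouville
import Mathlib.Analysis.Calculus.IteratedDeriv.Lemmas
import Mathlib.Analysis.SpecialFunctions.Complex.LogDeriv
import Literature.MathematicalPhysics.QuantumLattice.DWaveSourceFreeComplexModes

/-!
# Zero-source pair-field cumulant bounds of the FREE `d`-wave–sourced torus (hypothesis (K) at `U = 0`)

Topic `MathematicalPhysics/QuantumLattice` (companion of `DWaveSourceFreeComplexModes.lean` and
`ComplexSourceCumulantBound.lean`). The Taylor coefficients at `h = 0` of `log Z_L(h)`,
`Z_L(h) = tr e^{-β(hubbardTorusWith 2 L 1 0 μ - h(Δ_d + Δ_d†))}` — `m!`-normalised zero-source cumulants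
of the macroscopic `d`-wave pair field of the free gas — obey the dimensional bound

  `‖(m!)⁻¹ (log Z_L)⁽ᵐ⁾(0)‖ ≤ A(1 + log β) · βL² · (Bβ)ᵐ⁻²`   (`m ≥ 2`, `β ≥ 1`, `L ≥ max(3,⌈β⌉)`),

uniformly for `μ` in compacts of `(-4,0)` (`dWaveSource_free_pairCumulantBound`, `B = 16`,
`A = 96(C+8)` with `C` the torus Cooper-logarithm constant): this is hypothesis (K) of the reduction
`Summits/HubbardSuperconductivity/…/ThermalWedgeTwSourcedInertnessDiscOfCumulants` of crux
`TwSourcedInertness` (route `ThermalWedge`), certified at `U = 0` with the expected shape — source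
radius `∝ 1/β`, Cooper logarithm in the prefactor.

Mechanism (`norm_iteratedDeriv_log_partitionFn_dWaveSource_free_le`): on the complex source disc
`‖h‖ < 2r`, `256(βr)² ≤ 1`, every BdG mode ratio is within `1/2` of `1`
(`DWaveSourceFreeComplexModes`), so `G(h) = Σ_k log ratio_k(h)` is holomorphic with
`Z_L(h) = Z_L(0)e^{G(h)}`, `log Z_L = log Z_L(0) + G` near `0`, and
`‖G‖ ≤ 96βr² Σ_k β/(2+β|ξ_k|)` on `‖h‖ = r`; Cauchy's estimate for `G` and the torus Cooper logarithm
`Σ_k β/(2+β|ξ_k|) ≤ C(1+log β)L² + 8βL` (`exists_sum_fermiWeight_le`) finish, with `r = 1/(16β)`.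
In particular the free `Z_L` is zero-free on `‖h‖ < 1/(16β)` with `|p̃_L(s) - p̃_L(0)| ≤ 2A(1+log β)s²`
for `|s| ≤ 1/(32β)` (`ComplexSourceCumulantBound`), independently of the free Lee–Yang theorem.
Everything is PROVED; no definition is introduced.

## References

* D. Ruelle, *Statistical Mechanics: Rigorous Results* (1969), §4.4. [Ruelle1969]
* E. C. Titchmarsh, *The Theory of Functions* (1939), §2.5 (Cauchy's inequality). [Titchmarsh1939]
-/

noncomputable section

open Complex Finset Filter Metric Set
open scoped Nat Topology Matrix.Norms.L2Operator ComplexOrder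
open Matrix Literature.Probability.LatticeModels

namespace Literature.MathematicalPhysics.QuantumLattice

variable (L : ℕ) [NeZero L]

/-! ### Cauchy estimates for `log Z_L` on the source disc `‖h‖ ≤ r`, `16βr ≤ 1` -/

omit [NeZero L] in
/-- The smallness parameter of mode `k` on the disc `‖z‖ ≤ 2r`: with `256(βr)² ≤ 1`,
`β · 8‖z‖²ĝ_d(k)² · β/(2 + β|ξ_k|) ≤ 1/4`. [folklore] -/
theorem bdgMode_smallness {β r : ℝ} (hβ : 0 < β) (hsmall : 256 * (β * r) ^ 2 ≤ 1) {z : ℂ}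
    (hz : ‖z‖ ≤ 2 * r) (k : TorusSite 2 L) (ξ : ℝ) :
    β * (8 * ‖z‖ ^ 2 * dWaveGap k ^ 2) * (β / (2 + β * |ξ|)) ≤ 1 / 4 := by
  have hg : dWaveGap k ^ 2 ≤ 4 := by
    have h1 := abs_dWaveGap_le_two k
    rw [← sq_abs]; nlinarith [abs_nonneg (dWaveGap k)]
  have hw : β / (2 + β * |ξ|) ≤ β / 2 := by
    apply div_le_div_of_nonneg_left hβ.le two_pos
    have : 0 ≤ β * |ξ| := by positivity
    linarith
  have hz2 : ‖z‖ ^ 2 ≤ (2 * r) ^ 2 := pow_le_pow_left₀ (norm_nonneg _) hz 2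
  calc β * (8 * ‖z‖ ^ 2 * dWaveGap k ^ 2) * (β / (2 + β * |ξ|))
      ≤ β * (8 * (2 * r) ^ 2 * 4) * (β / 2) := by gcongr
    _ = 64 * (β * r) ^ 2 := by ring
    _ ≤ 1 / 4 := by linarith

/-- **Cauchy estimate for the Taylor coefficients of `log Z_L` at zero source (free torus).** For
`U = 0`, `L ≥ 3`, `β > 0` and a radius `r > 0` with `256(βr)² ≤ 1`, for every `m ≥ 1`:
`‖(log Z_L)⁽ᵐ⁾(0)‖ ≤ m! · (96 β r² Σ_k β/(2 + β|ξ_k - μ|)) / rᵐ`.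
Mechanism: on `‖h‖ < 2r` every BdG mode ratio is within `1/2` of `1`
(`norm_bdgModeRatio_sub_one_le`), so `G(h) = Σ_k log(ratio_k(h))` is holomorphic there with
`Z_L(h) = Z_L(0) e^{G(h)}` (`partitionFn_dWaveSource_free_eq_prod`), `log Z_L = log Z_L(0) + G`
near `0`, `‖G‖ ≤ 96βr² Σ_k β/(2+β|ξ_k|)` on `‖h‖ = r` (`norm_log_bdgModeRatio_le`, `ĝ_d² ≤ 4`), and
Cauchy's estimate applies to `G`. [cite: Ruelle1969, §4.4] -/
theorem norm_iteratedDeriv_log_partitionFn_dWaveSource_free_le (hL : 3 ≤ L) {β : ℝ} (hβ : 0 < β)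
    (μ : ℝ) {r : ℝ} (hr : 0 < r) (hsmall : 256 * (β * r) ^ 2 ≤ 1) {m : ℕ} (hm : 1 ≤ m) :
    ‖iteratedDeriv m (fun z : ℂ => Complex.log (partitionFn β (hubbardTorusWith 2 L 1 0 μ -
        z • (pairField dWaveFormFactor L + (pairField dWaveFormFactor L)ᴴ)))) 0‖ ≤
      m ! * (96 * β * r ^ 2 * ∑ k : TorusSite 2 L, β / (2 + β * |torusBand L k - μ|)) / r ^ m := by
  obtain ⟨C, hC, hCsq, -⟩ := exists_coshSqrt β
  -- notation (`ξ_k = torusBand L k - μ`, cast to `ℂ` as a whole)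
  set ratio : TorusSite 2 L → ℂ → ℂ := fun k z =>
    (1 + C ((Complex.ofReal (torusBand L k - μ)) ^ 2 + ((2 * Real.sqrt 2 : ℂ) * z * (dWaveGap k : ℂ)) ^ 2)) /
      (1 + Complex.cosh ((β : ℂ) * (Complex.ofReal (torusBand L k - μ)))) with hratio
  set G : ℂ → ℂ := fun z => ∑ k : TorusSite 2 L, Complex.log (ratio k z) with hGdef
  set Z : ℂ → ℂ := fun z => partitionFn β (hubbardTorusWith 2 L 1 0 μ -
      z • (pairField dWaveFormFactor L + (pairField dWaveFormFactor L)ᴴ)) with hZdef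
  set S : ℝ := ∑ k : TorusSite 2 L, β / (2 + β * |torusBand L k - μ|) with hSdef
  -- smallness on the big disc
  have hsm : ∀ z : ℂ, ‖z‖ ≤ 2 * r → ∀ k : TorusSite 2 L,
      β * (8 * ‖z‖ ^ 2 * dWaveGap k ^ 2) * (β / (2 + β * |torusBand L k - μ|)) ≤ 1 / 4 :=
    fun z hz k => bdgMode_smallness L hβ hsmall hz k ((torusBand L k - μ))
  -- positivity of the real denominators
  have hdpos : ∀ k : TorusSite 2 L, 0 < 1 + Real.cosh (β * (torusBand L k - μ)) := fun k => by
    have := Real.cosh_pos (β * (torusBand L k - μ)); linarith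
  have hden : ∀ k : TorusSite 2 L, (1 : ℂ) + Complex.cosh ((β : ℂ) * Complex.ofReal (torusBand L k - μ)) =
      ((1 + Real.cosh (β * (torusBand L k - μ)) : ℝ) : ℂ) := fun k => by
    rw [Complex.ofReal_add, Complex.ofReal_one, Complex.ofReal_cosh, Complex.ofReal_mul]
  have hden_ne : ∀ k : TorusSite 2 L,
      (1 : ℂ) + Complex.cosh ((β : ℂ) * Complex.ofReal (torusBand L k - μ)) ≠ 0 := fun k => by
    rw [hden k]; exact_mod_cast (hdpos k).ne'
  -- holomorphy of `G` on the big disc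
  have hratio_d : ∀ k : TorusSite 2 L, Differentiable ℂ (ratio k) := by
    intro k
    have hin : Differentiable ℂ (fun z : ℂ =>
        (Complex.ofReal (torusBand L k - μ)) ^ 2 + ((2 * Real.sqrt 2 : ℂ) * z * (dWaveGap k : ℂ)) ^ 2) := by
      fun_prop
    have hc : Differentiable ℂ (fun z : ℂ =>
        C ((Complex.ofReal (torusBand L k - μ)) ^ 2 + ((2 * Real.sqrt 2 : ℂ) * z * (dWaveGap k : ℂ)) ^ 2)) :=
      hC.comp hin
    exact (hc.const_add 1).div_const _
  have hGd : DifferentiableOn ℂ G (ball (0 : ℂ) (2 * r)) := by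
    intro z hz
    have hz' : ‖z‖ ≤ 2 * r := (mem_ball_zero_iff.mp hz).le
    refine (DifferentiableAt.fun_sum (u := Finset.univ) fun k _ => ?_).differentiableWithinAt
    exact ((hratio_d k) z).clog (bdgModeRatio_mem_slitPlane hβ hCsq ((torusBand L k - μ)) (dWaveGap k) z (hsm z hz' k))
  -- `Z z = Z 0 * exp (G z)` on the big disc
  have hZ0 : Z 0 = (2 : ℂ) ^ Fintype.card (Orb (FermionTorus 2 L)) *
      ∏ k : TorusSite 2 L, ((Real.exp (-(β * (torusBand L k - μ))) : ℂ) *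
        ((1 + Complex.cosh ((β : ℂ) * (Complex.ofReal (torusBand L k - μ)))) / 2)) := by
    have := partitionFn_dWaveSource_free_eq_prod L hL β μ hC hCsq 0
    rw [hZdef]
    simp only at this ⊢
    rw [this]
    congr 1
    refine Finset.prod_congr rfl fun k _ => ?_
    rw [mul_zero, zero_mul, zero_pow two_ne_zero, add_zero, hCsq]
  have hexpG : ∀ z : ℂ, ‖z‖ ≤ 2 * r → Z z = Z 0 * Complex.exp (G z) := by
    intro z hz
    have hprod : Complex.exp (G z) = ∏ k : TorusSite 2 L, ratio k z := by
      rw [hGdef]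
      simp only
      rw [Complex.exp_sum]
      refine Finset.prod_congr rfl fun k _ => Complex.exp_log ?_
      exact slitPlane_ne_zero (bdgModeRatio_mem_slitPlane hβ hCsq ((torusBand L k - μ)) (dWaveGap k) z (hsm z hz k))
    rw [hprod, hZ0, hZdef]
    simp only
    rw [partitionFn_dWaveSource_free_eq_prod L hL β μ hC hCsq z]
    conv_rhs => rw [mul_assoc, ← Finset.prod_mul_distrib]
    congr 1
    refine Finset.prod_congr rfl fun k _ => ?_
    rw [hratio]
    simp only
    rw [mul_assoc ((Real.exp (-(β * (torusBand L k - μ))) : ℂ)), div_mul_div_comm,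
      mul_comm ((1 : ℂ) + Complex.cosh _) ((1 : ℂ) + C _), mul_div_mul_right _ _ (hden_ne k)]
  -- `log Z = log Z 0 + G` near `0`
  have hG0 : G 0 = 0 := by
    rw [hGdef]; simp only
    refine Finset.sum_eq_zero fun k _ => ?_
    have : ratio k 0 = 1 := by
      rw [hratio]; simp only
      rw [mul_zero, zero_mul, zero_pow two_ne_zero, add_zero, hCsq, div_self (hden_ne k)]
    rw [this, Complex.log_one]
  have hGcont : ContinuousAt G 0 :=
    (hGd.differentiableAt (ball_mem_nhds 0 (by positivity))).continuousAt
  have hZpos : 0 < Z 0 := by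
    have hH : (hubbardTorusWith 2 L 1 0 μ -
        (0 : ℂ) • (pairField dWaveFormFactor L + (pairField dWaveFormFactor L)ᴴ)).IsHermitian := by
      rw [zero_smul, sub_zero]; exact isHermitian_hamiltonianWith (fermionTorusGraph 2 L) 1 0 μ
    have := partitionFn_pos β hH
    simpa [hZdef] using this
  have hP : 0 < (Z 0).re := (Complex.pos_iff.1 hZpos).1
  have hZ0real : Z 0 = (((Z 0).re : ℝ) : ℂ) := by
    obtain ⟨_, him⟩ := Complex.pos_iff.1 hZpos
    apply Complex.ext
    · simp
    · simp only [Complex.ofReal_im]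
      exact him.symm
  have hev : (fun z => Complex.log (Z z)) =ᶠ[𝓝 (0 : ℂ)] fun z => (Real.log (Z 0).re : ℂ) + G z := by
    have h1 : ∀ᶠ z in 𝓝 (0 : ℂ), ‖G z‖ < Real.pi := by
      have : Tendsto G (𝓝 0) (𝓝 0) := by simpa [hG0] using hGcont.tendsto
      exact (this.norm.eventually (gt_mem_nhds (by simpa using Real.pi_pos)))
    have h2 : ∀ᶠ z in 𝓝 (0 : ℂ), ‖z‖ ≤ 2 * r := by
      filter_upwards [closedBall_mem_nhds (0 : ℂ) (by positivity : (0 : ℝ) < 2 * r)] with z hz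
      simpa using hz
    filter_upwards [h1, h2] with z hz1 hz2
    rw [hexpG z hz2, hZ0real, Complex.ofReal_re, Complex.log_ofReal_mul hP (Complex.exp_ne_zero _),
      Complex.log_exp]
    · have := (abs_im_le_norm (G z)).trans_lt hz1
      exact (abs_lt.1 this).1
    · have := (abs_im_le_norm (G z)).trans_lt hz1
      exact (abs_lt.1 this).2.le
  have hder : iteratedDeriv m (fun z => Complex.log (Z z)) 0 = iteratedDeriv m G 0 := by
    rw [hev.iteratedDeriv_eq]
    obtain ⟨j, rfl⟩ := Nat.exists_eq_add_of_le' hm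
    rw [iteratedDeriv_const_add (Nat.succ_pos j)]
  -- Cauchy estimate on the small disc
  have hdcc : DiffContOnCl ℂ G (ball (0 : ℂ) r) :=
    hGd.diffContOnCl_ball (closedBall_subset_ball (by linarith))
  have hbound : ∀ z ∈ sphere (0 : ℂ) r, ‖G z‖ ≤ 96 * β * r ^ 2 * S := by
    intro z hz
    have hzr : ‖z‖ = r := by simpa using hz
    have hz2 : ‖z‖ ≤ 2 * r := by linarith
    rw [hGdef]
    simp only
    calc ‖∑ k : TorusSite 2 L, Complex.log (ratio k z)‖
        ≤ ∑ k : TorusSite 2 L, ‖Complex.log (ratio k z)‖ := norm_sum_le _ _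
      _ ≤ ∑ k : TorusSite 2 L, 3 * (β * (8 * ‖z‖ ^ 2 * dWaveGap k ^ 2) * (β / (2 + β * |torusBand L k - μ|))) :=
          Finset.sum_le_sum fun k _ => norm_log_bdgModeRatio_le hβ hCsq ((torusBand L k - μ)) (dWaveGap k) z (hsm z hz2 k)
      _ ≤ ∑ k : TorusSite 2 L, 96 * β * r ^ 2 * (β / (2 + β * |torusBand L k - μ|)) := by
          refine Finset.sum_le_sum fun k _ => ?_
          have hg : dWaveGap k ^ 2 ≤ 4 := by
            have h1 := abs_dWaveGap_le_two k
            rw [← sq_abs]; nlinarith [abs_nonneg (dWaveGap k)]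
          have hw : 0 ≤ β / (2 + β * |torusBand L k - μ|) := by positivity
          rw [hzr]
          calc 3 * (β * (8 * r ^ 2 * dWaveGap k ^ 2) * (β / (2 + β * |torusBand L k - μ|)))
              ≤ 3 * (β * (8 * r ^ 2 * 4) * (β / (2 + β * |torusBand L k - μ|))) := by gcongr
            _ = 96 * β * r ^ 2 * (β / (2 + β * |torusBand L k - μ|)) := by ring
      _ = 96 * β * r ^ 2 * S := by rw [hSdef, ← Finset.mul_sum]
  have hC := Complex.norm_iteratedDeriv_le_of_forall_mem_sphere_norm_le m hr hdcc hbound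
  rw [hZdef] at hder
  simp only at hder
  rw [hder]
  exact hC


/-! ### The pair-field cumulant bound (K) of the free torus -/

/-- **Pair-field cumulant bounds at zero source for the FREE torus — hypothesis (K) of
`Summits/…/ThermalWedgeTwSourcedInertnessDiscOfCumulants` at `U = 0`, with explicit constants.** For
every compact `[μ₁,μ₂] ⊂ (-4,0)` there are `A, B > 0` (`B = 16`, `A = 96(C+8)` with `C` the torus
Cooper-logarithm constant of `exists_sum_fermiWeight_le`) such that for `β ≥ 1`, `μ ∈ [μ₁,μ₂]`,
`L ≥ max(3,⌈β⌉)` and every `m ≥ 2`: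

  `‖(m!)⁻¹ (log Z_L)⁽ᵐ⁾(0)‖ ≤ A(1 + log β) · βL² · (Bβ)ᵐ⁻²`,

`Z_L(h) = tr e^{-β(hubbardTorusWith 2 L 1 0 μ - h(Δ_d + Δ_d†))}`: the `m`-th zero-source cumulant of the
macroscopic `d`-wave pair field of the free gas has the one-loop dimensional size `βL² · βᵐ⁻²` with
the Cooper logarithm — Cauchy's estimate on the source disc of radius `1/(16β)`
(`norm_iteratedDeriv_log_partitionFn_dWaveSource_free_le`) and the torus Cooper logarithm
`Σ_k β/(2+β|ξ_k|) ≤ C(1+log β)L² + 8βL`. [cite: Ruelle1969, §4.4] -/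
theorem dWaveSource_free_pairCumulantBound :
    ∀ μ₁ μ₂ : ℝ, -4 < μ₁ → μ₁ ≤ μ₂ → μ₂ < 0 → ∃ A B : ℝ, 0 < A ∧ 0 < B ∧
      ∀ β : ℝ, 1 ≤ β → ∀ μ ∈ Set.Icc μ₁ μ₂, ∃ L₀ : ℕ, ∀ (L : ℕ) [NeZero L], L₀ ≤ L →
      ∀ m : ℕ, 2 ≤ m →
      ‖((m ! : ℂ))⁻¹ * iteratedDeriv m (fun z : ℂ => Complex.log (partitionFn β
          (hubbardTorusWith 2 L 1 0 μ -
            z • (pairField dWaveFormFactor L + (pairField dWaveFormFactor L)ᴴ)))) 0‖ ≤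
        A * (1 + Real.log β) * (β * (L : ℝ) ^ 2) * (B * β) ^ (m - 2) := by
  intro μ₁ μ₂ h4 _h12 h0
  set d₀ := min (μ₁ + 4) (-μ₂) with hd₀def
  have hd₀ : 0 < d₀ := lt_min (by linarith) (by linarith)
  obtain ⟨C, hC, hsum⟩ := exists_sum_fermiWeight_le hd₀
  refine ⟨96 * (C + 8), 16, by positivity, by norm_num, ?_⟩
  intro β hβ μ hμ
  have hβ0 : 0 < β := by linarith
  have hμ4 : d₀ ≤ μ + 4 := (min_le_left _ _).trans (by linarith [hμ.1])
  have hμ0 : d₀ ≤ -μ := (min_le_right _ _).trans (by linarith [hμ.2])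
  refine ⟨max 3 ⌈β⌉₊, fun L _ hL m hm => ?_⟩
  have hL3 : 3 ≤ L := le_of_max_le_left hL
  have hLβ : β ≤ L := (Nat.le_ceil β).trans (by exact_mod_cast le_of_max_le_right hL)
  have hLpos : (0 : ℝ) < L := by exact_mod_cast Nat.pos_of_ne_zero (NeZero.ne L)
  -- the radius `r = 1/(16β)`
  set r : ℝ := 1 / (16 * β) with hr
  have hrpos : 0 < r := by positivity
  have hβr : β * r = 1 / 16 := by rw [hr]; field_simp
  have hsmall : 256 * (β * r) ^ 2 ≤ 1 := by rw [hβr]; norm_num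
  have key := norm_iteratedDeriv_log_partitionFn_dWaveSource_free_le L hL3 hβ0 μ hrpos hsmall
    (m := m) (by omega)
  set S : ℝ := ∑ k : TorusSite 2 L, β / (2 + β * |torusBand L k - μ|) with hSdef
  have hS0 : 0 ≤ S := Finset.sum_nonneg fun k _ => by positivity
  have hS : S ≤ (C + 8) * (1 + Real.log β) * (L : ℝ) ^ 2 := by
    have h1 := hsum μ hμ4 hμ0 β hβ L
    have hlog : 0 ≤ Real.log β := Real.log_nonneg hβ
    have h2 : β * (L : ℝ) ≤ (L : ℝ) ^ 2 := by
      rw [sq]; exact mul_le_mul_of_nonneg_right hLβ hLpos.le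
    have h3 : 8 * β * (L : ℝ) ≤ 8 * (1 + Real.log β) * (L : ℝ) ^ 2 := by nlinarith
    calc S ≤ C * (1 + Real.log β) * (L : ℝ) ^ 2 + 8 * β * L := h1
      _ ≤ C * (1 + Real.log β) * (L : ℝ) ^ 2 + 8 * (1 + Real.log β) * (L : ℝ) ^ 2 := by linarith
      _ = (C + 8) * (1 + Real.log β) * (L : ℝ) ^ 2 := by ring
  -- `‖(m!)⁻¹ D‖ = ‖D‖/m!`
  rw [norm_mul, norm_inv, Complex.norm_natCast]
  have hmfac : (0 : ℝ) < (m ! : ℝ) := by positivity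
  rw [inv_mul_le_iff₀ hmfac]
  refine key.trans ?_
  obtain ⟨j, rfl⟩ := Nat.exists_eq_add_of_le' hm
  simp only [Nat.add_sub_cancel]
  -- `r² / r^{j+2} = (16β)^j`
  have hrj : r ^ 2 / r ^ (j + 2) = (16 * β) ^ j := by
    rw [pow_add, div_mul_cancel_right₀ (pow_ne_zero 2 hrpos.ne'), hr, one_div, inv_pow, inv_inv]
  have e : ((j + 2) ! : ℝ) * (96 * β * r ^ 2 * S) / r ^ (j + 2) =
      ((j + 2) ! : ℝ) * (96 * β * S * (16 * β) ^ j) := by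
    rw [← hrj]; field_simp
  rw [e]
  refine mul_le_mul_of_nonneg_left ?_ hmfac.le
  have hw : 0 ≤ 96 * β * (16 * β) ^ j := by positivity
  calc 96 * β * S * (16 * β) ^ j = 96 * β * (16 * β) ^ j * S := by ring
    _ ≤ 96 * β * (16 * β) ^ j * ((C + 8) * (1 + Real.log β) * (L : ℝ) ^ 2) :=
        mul_le_mul_of_nonneg_left hS hw
    _ = 96 * (C + 8) * (1 + Real.log β) * (β * (L : ℝ) ^ 2) * (16 * β) ^ j := by ring

end Literature.MathematicalPhysics.QuantumLattice
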